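import Mathlib
import HarnessLib
import Summits.Ventures.LatticeQCDFlow.Exactness.SphereLatticeMoments
import Summits.Ventures.LatticeQCDFlow.Exactness.SphereLuscherSeriesConstants

/-!
# The variance of the lattice CP(N−1)/O(N) action under the uniform measure in closed form: `Var_π̄(S) = ċ₁ = (2κ²/d²)·Σ_{n,m} ‖U_{nm}‖²_HS`

HONEST FRAMING: exact (Metropolis-corrected) sampling algorithms for lattice gauge theory;
figures of merit are autocorrelation/cost numbers at stated couplings and volumes; no
continuum-physics claim.

Venture `LatticeQCDFlow` (cell pub-lqcd), topic `Exactness`; FANOUT row 7 (`s0-cpn-null`).  NEW WORK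
of the cell over the tree's `Exactness/SphereLatticeMoments.lean` (this leg: first and second
moments of `π̄` from Green's identity), `Exactness/SphereLuscherSeriesConstants.lean` (this leg:
`ċ₁ = ∫(S − S₀)²dπ̄`, `∫S dπ̄ = S₀`), `Exactness/SphereLuscherRecursionVariance.lean` (Green under
`π̄`), `Exactness/SphereLOFlowAction.lean` (E–S eq. (13) `∂̃_kS = −2κ P_{x_k}J_k` and
`−Σ∂̃²S = 2(d−1)(S − S₀)`) and `Exactness/SphereGeodesicKick.lean` (`‖P_xJ‖² = ‖J‖² − ⟪J,x⟫²`);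
nothing is cited as a fact.  Printed counterpart, NAMED ONLY: Engel–Schaefer, Comput. Phys. Commun.
182 (2011) 2107, §2 eqs. (6)–(7), §3 eq. (13); M. Lüscher, Commun. Math. Phys. 293 (2010) 899, §3.2
(the constants of the recursion).  The second cumulant of the action under the a-priori measure is
the leading strong-coupling datum of the model; here it is computed EXACTLY for arbitrary finite
lattices and transporters, and identified with Lüscher's order-one constant `ċ₁`
(`SphereLuscherSeriesConstants.luscher_constant_one_eq`).

## Setting

`d = dim E ≥ 2`, `Λ` finite nonempty, `π̄ = ⊗_Λ σ̄`; E–S couplings `U` (no self-coupling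
`U_{nn} = 0`, adjoint pairs `U_{mn} = U_{nm}†`); `S = esAction κ S₀ U = −κ Σ_n ⟪x_n, J_n⟫ + S₀`,
`J_n = Σ_m U_{nm} x_m`; `b = stdOrthonormalBasis ℝ E`; `‖U‖²_HS = Σ_i ‖U b_i‖²`.

## Content

* §1 **`dirichlet_esAction_eq_variance`** — `Σ_k ∫‖∂̃_kS‖² dπ̄ = 2(d−1)·∫(S − S₀)² dπ̄` (Green +
  the eigenfunction property); `norm_sq_siteGrad_esAction` (`‖∂̃_kS‖² = 4κ²(‖J_k‖² − ⟪J_k, x_k⟫²)` on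
  `Ω`).
* §2 THE TWO LATTICE SUMS: `integral_inner_clm_apply_clm_apply` (`∫⟪V x_m, W x_{m'}⟫ dπ̄ =
  [m = m']·Σ_i⟪V b_i, W b_i⟫/d`), **`integral_norm_sq_localField`**
  (`∫‖J_k‖² dπ̄ = Σ_m ‖U_{km}‖²_HS / d` — cross terms are affine in one site) and
  **`integral_sq_inner_localField`** (`∫⟪J_k, x_k⟫² dπ̄ = Σ_m ‖U_{km}‖²_HS / d²`).
* §3 **`variance_esAction_eq`** — `∫(S − S₀)² dπ̄ = (2κ²/d²)·Σ_k Σ_m ‖U_{km}‖²_HS`: THE VARIANCE OF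
  THE LATTICE CP(N−1)/O(N) ACTION UNDER THE UNIFORM PRODUCT MEASURE, IN CLOSED FORM, for every finite
  lattice and every family of transporters with `U_{nn} = 0`, `U_{mn} = U_{nm}†`;
  **`luscher_constant_one_eq_sum`** — hence `ċ₁ = (2κ²/d²)·Σ_{k,m} ‖U_{km}‖²_HS` for every `C²`
  Lüscher series of `S` — linear in the number of links, e.g. `= 2κ²·#{(k,m) : U_{km} ≠ 0}/d` when
  every nonzero transporter is an isometry (**`variance_esAction_eq_of_isometric`**, U(1) phases:
  `‖U‖²_HS = d`, `sum_norm_sq_apply_of_isometric`).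

NOT CLAIMED: higher cumulants / `ċ_k` for `k ≥ 2`; anything at `t > 0`; the interacting measure;
anything about autocorrelations or the rung's numbers.
-/

noncomputable section

namespace Summit.Ventures.LatticeQCDFlow.Exactness

open Function Set Metric MeasureTheory NormedSpace InnerProductSpace
open scoped RealInnerProductSpace

variable {Λ : Type*} {E : Type*} [NormedAddCommGroup E] [InnerProductSpace ℝ E]
  [FiniteDimensional ℝ E] [MeasurableSpace E] [BorelSpace E]

/-! ## §1 The Dirichlet form of the action is `2(d−1)` times its variance -/

section Dirichlet

variable [Fintype Λ] [DecidableEq Λ] [Nontrivial E] {U : Λ → Λ → (E →L[ℝ] E)}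

/-- **`Σ_k ∫‖∂̃_kS‖² dπ̄ = 2(d−1)·∫(S − S₀)² dπ̄`**: the Green identity `∫S·(−Σ∂̃²S) = Σ∫‖∂̃S‖²`,
E–S's `−Σ∂̃²S = 2(d−1)(S − S₀)` on `Ω`, and `∫S dπ̄ = S₀`. -/
theorem dirichlet_esAction_eq_variance (h2 : 2 ≤ Module.finrank ℝ E) (hU0 : ∀ n, U n n = 0)
    (hUadj : ∀ m n (v w : E), ⟪U m n v, w⟫ = ⟪v, U n m w⟫) (κ S₀ : ℝ) :
    ∑ k, ∫ ω, ‖siteGrad k (esAction κ S₀ U) (fun n => ((ω : Λ → sphere (0 : E) 1) n : E))‖ ^ 2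
        ∂Measure.pi (fun _ : Λ => uniformSphere (volume : Measure E)) =
      2 * ((Module.finrank ℝ E : ℝ) - 1) *
        ∫ ω, (esAction κ S₀ U (fun n => ((ω : Λ → sphere (0 : E) 1) n : E)) - S₀) ^ 2
          ∂Measure.pi (fun _ : Λ => uniformSphere (volume : Measure E)) := by
  have hS2 : ContDiff ℝ 2 (esAction κ S₀ U) := contDiff_esAction U κ S₀
  have hSc : Continuous fun ω : Λ → sphere (0 : E) 1 => esAction κ S₀ U (fun n => (ω n : E)) :=
    hS2.continuous.comp continuous_sphereConfig
  rw [← integral_mul_luscher_uniform hS2]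
  have heig : ∀ ω : Λ → sphere (0 : E) 1,
      -∑ k, siteLaplacian k (esAction κ S₀ U) (fun n => (ω n : E)) =
        2 * ((Module.finrank ℝ E : ℝ) - 1) * (esAction κ S₀ U (fun n => (ω n : E)) - S₀) :=
    fun ω => neg_sum_siteLaplacian_esAction hU0 hUadj κ S₀ fun n => by simp
  simp_rw [heig]
  have hmean : ∫ ω, (esAction κ S₀ U (fun n => ((ω : Λ → sphere (0 : E) 1) n : E)) - S₀)
      ∂Measure.pi (fun _ : Λ => uniformSphere (volume : Measure E)) = 0 := by
    rw [integral_sub (integrable_pi_of_continuous _ hSc) (integrable_const _),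
      integral_esAction_uniform hU0 hUadj h2 κ S₀, integral_const, smul_eq_mul, Measure.real,
      measure_univ, ENNReal.toReal_one, one_mul, sub_self]
  have hi1 : Integrable (fun ω : Λ → sphere (0 : E) 1 =>
      2 * ((Module.finrank ℝ E : ℝ) - 1) * (esAction κ S₀ U (fun n => (ω n : E)) - S₀) ^ 2)
      (Measure.pi fun _ : Λ => uniformSphere (volume : Measure E)) :=
    (integrable_pi_of_continuous _ ((hSc.sub continuous_const).pow 2)).const_mul _
  have hi2 : Integrable (fun ω : Λ → sphere (0 : E) 1 =>
      2 * ((Module.finrank ℝ E : ℝ) - 1) * S₀ * (esAction κ S₀ U (fun n => (ω n : E)) - S₀))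
      (Measure.pi fun _ : Λ => uniformSphere (volume : Measure E)) :=
    (integrable_pi_of_continuous _ (hSc.sub continuous_const)).const_mul _
  have hfun : (fun ω : Λ → sphere (0 : E) 1 => esAction κ S₀ U (fun n => (ω n : E)) *
      (2 * ((Module.finrank ℝ E : ℝ) - 1) * (esAction κ S₀ U (fun n => (ω n : E)) - S₀))) =
      fun ω => 2 * ((Module.finrank ℝ E : ℝ) - 1) * (esAction κ S₀ U (fun n => (ω n : E)) - S₀) ^ 2 +
        2 * ((Module.finrank ℝ E : ℝ) - 1) * S₀ * (esAction κ S₀ U (fun n => (ω n : E)) - S₀) := by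
    funext ω; ring
  rw [hfun, integral_add hi1 hi2, integral_const_mul, integral_const_mul, hmean, mul_zero, add_zero]

omit [MeasurableSpace E] [BorelSpace E] [Nontrivial E] in
/-- **`‖∂̃_kS‖² = 4κ²(‖J_k‖² − ⟪J_k, x_k⟫²)` on the product of unit spheres** (E–S eq. (13) and
`‖P_xJ‖² = ‖J‖² − ⟪J, x⟫²`). -/
theorem norm_sq_siteGrad_esAction (hU0 : ∀ n, U n n = 0)
    (hUadj : ∀ m n (v w : E), ⟪U m n v, w⟫ = ⟪v, U n m w⟫) (κ S₀ : ℝ) {x : Λ → E}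
    (hx : ∀ n, ‖x n‖ = 1) (k : Λ) :
    ‖siteGrad k (esAction κ S₀ U) x‖ ^ 2 =
      4 * κ ^ 2 * (‖localField U k x‖ ^ 2 - ⟪localField U k x, x k⟫ ^ 2) := by
  rw [siteGrad_esAction hU0 hUadj κ S₀ (hx k), norm_smul, mul_pow, norm_neg, Real.norm_eq_abs,
    abs_mul, abs_two, mul_pow, sq_abs, norm_tangentKick_sq (localField U k x) (hx k)]
  ring

end Dirichlet

/-! ## §2 The two lattice sums `∫‖J_k‖²` and `∫⟪J_k, x_k⟫²` -/

section Sums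

variable [Fintype Λ] [DecidableEq Λ] [Nontrivial E] {U : Λ → Λ → (E →L[ℝ] E)}

/-- Cross terms of `‖J_k‖²`: `∫⟪U_{km} x_m, U_{km'} x_{m'}⟫ dπ̄ = 0` for `m ≠ m'` (affine in `x_m`),
and `= ‖U_{km}‖²_HS/d` for `m = m'`. -/
theorem integral_inner_clm_apply_clm_apply (h2 : 2 ≤ Module.finrank ℝ E) (V W : E →L[ℝ] E)
    (m m' : Λ) :
    ∫ ω, ⟪V (((ω : Λ → sphere (0 : E) 1) m : E)), W ((ω m' : E))⟫
        ∂Measure.pi (fun _ : Λ => uniformSphere (volume : Measure E)) =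
      if m = m' then (∑ i, ⟪V (stdOrthonormalBasis ℝ E i), W (stdOrthonormalBasis ℝ E i)⟫) /
        (Module.finrank ℝ E : ℝ) else 0 := by
  by_cases hmm : m = m'
  · subst hmm
    rw [if_pos rfl]
    -- polarise through the standard basis: ⟪Vy, Wy⟫ = Σ_i ⟪V† b_i ... ⟫ — use Parseval on `W y`
    set B := stdOrthonormalBasis ℝ E
    have hpt : ∀ ω : Λ → sphere (0 : E) 1, ⟪V ((ω m : E)), W ((ω m : E))⟫ =
        ∑ i, ⟪ContinuousLinearMap.adjoint V (B i), (ω m : E)⟫ *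
          ⟪ContinuousLinearMap.adjoint W (B i), (ω m : E)⟫ := fun ω => by
      rw [← B.sum_inner_mul_inner (V (ω m : E)) (W (ω m : E))]
      refine Finset.sum_congr rfl fun i _ => ?_
      rw [← ContinuousLinearMap.adjoint_inner_left W, ← ContinuousLinearMap.adjoint_inner_right V,
        real_inner_comm (ContinuousLinearMap.adjoint V (B i))]
    simp_rw [hpt]
    have hc : Continuous fun ω : Λ → sphere (0 : E) 1 => ((ω m : sphere (0 : E) 1) : E) :=
      continuous_subtype_val.comp (continuous_apply m)
    have hI : ∀ i, Integrable (fun ω : Λ → sphere (0 : E) 1 =>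
        ⟪ContinuousLinearMap.adjoint V (B i), (ω m : E)⟫ *
          ⟪ContinuousLinearMap.adjoint W (B i), (ω m : E)⟫)
        (Measure.pi fun _ : Λ => uniformSphere (volume : Measure E)) := fun i =>
      integrable_pi_of_continuous _ ((continuous_const.inner hc).mul (continuous_const.inner hc))
    rw [integral_finsetSum Finset.univ fun i _ => hI i]
    simp_rw [integral_slin_mul_slin_same]
    rw [← Finset.sum_div]
    congr 1
    -- Σ_i ⟪V†b_i, W†b_i⟫ = Σ_i ⟪V b_i, W b_i⟫ (both are the trace of V†W in the basis b)
    have h1 : ∀ i, ⟪ContinuousLinearMap.adjoint V (B i), ContinuousLinearMap.adjoint W (B i)⟫ =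
        ∑ j, ⟪B i, V (B j)⟫ * ⟪B i, W (B j)⟫ := fun i => by
      rw [← B.sum_inner_mul_inner (ContinuousLinearMap.adjoint V (B i))
        (ContinuousLinearMap.adjoint W (B i))]
      refine Finset.sum_congr rfl fun j _ => ?_
      rw [ContinuousLinearMap.adjoint_inner_left, ContinuousLinearMap.adjoint_inner_right,
        real_inner_comm (B i) (W (B j))]
    have h2' : ∀ j, ⟪V (B j), W (B j)⟫ = ∑ i, ⟪B i, V (B j)⟫ * ⟪B i, W (B j)⟫ := fun j => by
      rw [← B.sum_inner_mul_inner (V (B j)) (W (B j))]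
      refine Finset.sum_congr rfl fun i _ => ?_
      rw [real_inner_comm (B i) (V (B j))]
    simp_rw [h1, h2']
    exact Finset.sum_comm
  · rw [if_neg hmm]
    have hF : ContDiff ℝ 2 (fun x : Λ → E => ⟪V (x m), W (x m')⟫) :=
      (V.contDiff.comp (contDiff_apply ℝ E m)).inner ℝ (W.contDiff.comp (contDiff_apply ℝ E m'))
    exact integral_eq_zero_of_site_affine (Λ := Λ) h2 hF m
      (fun x => ContinuousLinearMap.adjoint V (W (x m'))) fun x y => by
        simp only [update_self, update_of_ne (Ne.symm hmm)]
        rw [ContinuousLinearMap.adjoint_inner_left, real_inner_comm]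

/-- **`∫ ‖J_k‖² dπ̄ = Σ_m ‖U_{km}‖²_HS / d`.** -/
theorem integral_norm_sq_localField (h2 : 2 ≤ Module.finrank ℝ E) (U : Λ → Λ → (E →L[ℝ] E))
    (k : Λ) :
    ∫ ω, ‖localField U k (fun n => ((ω : Λ → sphere (0 : E) 1) n : E))‖ ^ 2
        ∂Measure.pi (fun _ : Λ => uniformSphere (volume : Measure E)) =
      (∑ m, ∑ i, ‖U k m (stdOrthonormalBasis ℝ E i)‖ ^ 2) / (Module.finrank ℝ E : ℝ) := by
  have hpt : ∀ ω : Λ → sphere (0 : E) 1, ‖localField U k (fun n => (ω n : E))‖ ^ 2 =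
      ∑ m, ∑ m', ⟪U k m ((ω m : E)), U k m' ((ω m' : E))⟫ := fun ω => by
    rw [← real_inner_self_eq_norm_sq, localField, sum_inner]
    exact Finset.sum_congr rfl fun m _ => by rw [inner_sum]
  simp_rw [hpt]
  have hc : ∀ m, Continuous fun ω : Λ → sphere (0 : E) 1 => U k m ((ω m : sphere (0 : E) 1) : E) :=
    fun m => (U k m).continuous.comp (continuous_subtype_val.comp (continuous_apply m))
  have hI : ∀ m m', Integrable (fun ω : Λ → sphere (0 : E) 1 =>
      ⟪U k m ((ω m : E)), U k m' ((ω m' : E))⟫)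
      (Measure.pi fun _ : Λ => uniformSphere (volume : Measure E)) := fun m m' =>
    integrable_pi_of_continuous _ ((hc m).inner (hc m'))
  have hI1 : ∀ m, Integrable (fun ω : Λ → sphere (0 : E) 1 =>
      ∑ m', ⟪U k m ((ω m : E)), U k m' ((ω m' : E))⟫)
      (Measure.pi fun _ : Λ => uniformSphere (volume : Measure E)) := fun m =>
    integrable_finsetSum Finset.univ fun m' _ => hI m m'
  rw [integral_finsetSum Finset.univ fun m _ => hI1 m]
  simp_rw [integral_finsetSum Finset.univ fun m' _ => hI _ m',
    integral_inner_clm_apply_clm_apply h2, Finset.sum_ite_eq, Finset.mem_univ, if_true,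
    real_inner_self_eq_norm_sq]
  rw [Finset.sum_div]

/-- **`∫ ⟪J_k, x_k⟫² dπ̄ = Σ_m ‖U_{km}‖²_HS / d²`** (no self-coupling: the `m = k` term is absent on
both sides; cross terms are affine in one site). -/
theorem integral_sq_inner_localField (h2 : 2 ≤ Module.finrank ℝ E) (hU0 : ∀ n, U n n = 0) (k : Λ) :
    ∫ ω, ⟪localField U k (fun n => ((ω : Λ → sphere (0 : E) 1) n : E)), ((ω k : sphere (0 : E) 1) : E)⟫ ^ 2
        ∂Measure.pi (fun _ : Λ => uniformSphere (volume : Measure E)) =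
      (∑ m, ∑ i, ‖U k m (stdOrthonormalBasis ℝ E i)‖ ^ 2) / (Module.finrank ℝ E : ℝ) ^ 2 := by
  -- the (m, m') term and its integral
  have hterm : ∀ m m', ∫ ω, ⟪U k m (((ω : Λ → sphere (0 : E) 1) m : E)), ((ω k : sphere (0 : E) 1) : E)⟫ *
      ⟪U k m' ((ω m' : E)), (ω k : E)⟫ ∂Measure.pi (fun _ : Λ => uniformSphere (volume : Measure E)) =
      if m = m' then (∑ i, ‖U k m (stdOrthonormalBasis ℝ E i)‖ ^ 2) / (Module.finrank ℝ E : ℝ) ^ 2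
        else 0 := by
    intro m m'
    by_cases hmk : m = k
    · -- the self-coupling term vanishes on both sides
      subst hmk
      simp [hU0]
    by_cases hmm : m = m'
    · subst hmm
      rw [if_pos rfl]
      have e : ∀ ω : Λ → sphere (0 : E) 1,
          ⟪U k m ((ω m : E)), ((ω k : sphere (0 : E) 1) : E)⟫ * ⟪U k m ((ω m : E)), (ω k : E)⟫ =
            ⟪((ω k : sphere (0 : E) 1) : E), U k m ((ω m : E))⟫ ^ 2 := fun ω => by
        rw [real_inner_comm, sq]
      simp_rw [e]
      exact integral_sq_inner_clm_apply (U k m) (Ne.symm hmk)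
    · rw [if_neg hmm]
      by_cases hm'k : m' = k
      · subst hm'k
        simp [hU0]
      have hF : ContDiff ℝ 2 (fun x : Λ → E => ⟪U k m (x m), x k⟫ * ⟪U k m' (x m'), x k⟫) :=
        (((U k m).contDiff.comp (contDiff_apply ℝ E m)).inner ℝ (contDiff_apply ℝ E k)).mul
          (((U k m').contDiff.comp (contDiff_apply ℝ E m')).inner ℝ (contDiff_apply ℝ E k))
      exact integral_eq_zero_of_site_affine (Λ := Λ) h2 hF m
        (fun x => ⟪U k m' (x m'), x k⟫ • ContinuousLinearMap.adjoint (U k m) (x k)) fun x y => by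
          simp only [update_self, update_of_ne (Ne.symm hmm), update_of_ne (Ne.symm hmk),
            real_inner_smul_left, ContinuousLinearMap.adjoint_inner_left]
          rw [real_inner_comm (x k) (U k m y)]
          ring
  have hpt : ∀ ω : Λ → sphere (0 : E) 1,
      ⟪localField U k (fun n => (ω n : E)), ((ω k : sphere (0 : E) 1) : E)⟫ ^ 2 =
        ∑ m, ∑ m', ⟪U k m ((ω m : E)), ((ω k : sphere (0 : E) 1) : E)⟫ *
          ⟪U k m' ((ω m' : E)), (ω k : E)⟫ := fun ω => by
    rw [localField, sum_inner, sq, Finset.sum_mul_sum]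
  simp_rw [hpt]
  have hc : ∀ m, Continuous fun ω : Λ → sphere (0 : E) 1 =>
      ⟪U k m ((ω m : sphere (0 : E) 1) : E), ((ω k : sphere (0 : E) 1) : E)⟫ := fun m =>
    ((U k m).continuous.comp (continuous_subtype_val.comp (continuous_apply m))).inner
      (continuous_subtype_val.comp (continuous_apply k))
  have hI : ∀ m m', Integrable (fun ω : Λ → sphere (0 : E) 1 =>
      ⟪U k m ((ω m : E)), ((ω k : sphere (0 : E) 1) : E)⟫ * ⟪U k m' ((ω m' : E)), (ω k : E)⟫)
      (Measure.pi fun _ : Λ => uniformSphere (volume : Measure E)) := fun m m' =>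
    integrable_pi_of_continuous _ ((hc m).mul (hc m'))
  have hI1 : ∀ m, Integrable (fun ω : Λ → sphere (0 : E) 1 =>
      ∑ m', ⟪U k m ((ω m : E)), ((ω k : sphere (0 : E) 1) : E)⟫ * ⟪U k m' ((ω m' : E)), (ω k : E)⟫)
      (Measure.pi fun _ : Λ => uniformSphere (volume : Measure E)) := fun m =>
    integrable_finsetSum Finset.univ fun m' _ => hI m m'
  rw [integral_finsetSum Finset.univ fun m _ => hI1 m]
  simp_rw [integral_finsetSum Finset.univ fun m' _ => hI _ m', hterm, Finset.sum_ite_eq,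
    Finset.mem_univ, if_true]
  rw [Finset.sum_div]

end Sums

/-! ## §3 The variance of the action in closed form -/

section Variance

variable [Fintype Λ] [DecidableEq Λ] [Nontrivial E] {U : Λ → Λ → (E →L[ℝ] E)}

/-- **THE VARIANCE OF THE LATTICE CP(N−1)/O(N) ACTION UNDER THE UNIFORM MEASURE, IN CLOSED FORM**:
`∫(S − S₀)² dπ̄ = (2κ²/d²) · Σ_k Σ_m ‖U_{km}‖²_HS` for every finite lattice and every family of
transporters with `U_{nn} = 0`, `U_{mn} = U_{nm}†` (`d = dim E ≥ 2`; `∫S dπ̄ = S₀`). -/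
theorem variance_esAction_eq (h2 : 2 ≤ Module.finrank ℝ E) (hU0 : ∀ n, U n n = 0)
    (hUadj : ∀ m n (v w : E), ⟪U m n v, w⟫ = ⟪v, U n m w⟫) (κ S₀ : ℝ) :
    ∫ ω, (esAction κ S₀ U (fun n => ((ω : Λ → sphere (0 : E) 1) n : E)) - S₀) ^ 2
        ∂Measure.pi (fun _ : Λ => uniformSphere (volume : Measure E)) =
      2 * κ ^ 2 / (Module.finrank ℝ E : ℝ) ^ 2 *
        ∑ k, ∑ m, ∑ i, ‖U k m (stdOrthonormalBasis ℝ E i)‖ ^ 2 := by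
  have hd1 : (0 : ℝ) < (Module.finrank ℝ E : ℝ) - 1 := by
    have : (2 : ℝ) ≤ Module.finrank ℝ E := by exact_mod_cast h2
    linarith
  have hd : (0 : ℝ) < (Module.finrank ℝ E : ℝ) := by linarith
  have hD := dirichlet_esAction_eq_variance (Λ := Λ) h2 hU0 hUadj κ S₀
  -- evaluate the Dirichlet form site by site
  have hsite : ∀ k, ∫ ω, ‖siteGrad k (esAction κ S₀ U) (fun n => ((ω : Λ → sphere (0 : E) 1) n : E))‖ ^ 2
      ∂Measure.pi (fun _ : Λ => uniformSphere (volume : Measure E)) =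
      4 * κ ^ 2 * ((∑ m, ∑ i, ‖U k m (stdOrthonormalBasis ℝ E i)‖ ^ 2) / (Module.finrank ℝ E : ℝ) -
        (∑ m, ∑ i, ‖U k m (stdOrthonormalBasis ℝ E i)‖ ^ 2) / (Module.finrank ℝ E : ℝ) ^ 2) := by
    intro k
    have hpt : ∀ ω : Λ → sphere (0 : E) 1,
        ‖siteGrad k (esAction κ S₀ U) (fun n => (ω n : E))‖ ^ 2 =
          4 * κ ^ 2 * (‖localField U k (fun n => (ω n : E))‖ ^ 2 -
            ⟪localField U k (fun n => (ω n : E)), ((ω k : sphere (0 : E) 1) : E)⟫ ^ 2) :=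
      fun ω => norm_sq_siteGrad_esAction hU0 hUadj κ S₀ (fun n => by simp) k
    simp_rw [hpt]
    have hJc : Continuous fun ω : Λ → sphere (0 : E) 1 => localField U k (fun n => (ω n : E)) :=
      (contDiff_localField U k (m := 0)).continuous.comp continuous_sphereConfig
    have hi1 : Integrable (fun ω : Λ → sphere (0 : E) 1 => ‖localField U k (fun n => (ω n : E))‖ ^ 2)
        (Measure.pi fun _ : Λ => uniformSphere (volume : Measure E)) :=
      integrable_pi_of_continuous _ (hJc.norm.pow 2)
    have hi2 : Integrable (fun ω : Λ → sphere (0 : E) 1 =>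
        ⟪localField U k (fun n => (ω n : E)), ((ω k : sphere (0 : E) 1) : E)⟫ ^ 2)
        (Measure.pi fun _ : Λ => uniformSphere (volume : Measure E)) :=
      integrable_pi_of_continuous _ ((hJc.inner (continuous_subtype_val.comp (continuous_apply k))).pow 2)
    rw [integral_const_mul, integral_sub hi1 hi2, integral_norm_sq_localField h2 U k,
      integral_sq_inner_localField h2 hU0 k]
  simp_rw [hsite] at hD
  rw [← Finset.mul_sum, Finset.sum_sub_distrib, ← Finset.sum_div, ← Finset.sum_div] at hD
  -- solve `4κ²(Σ/d − Σ/d²) = 2(d−1)·V` for `V`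
  have hne : 2 * ((Module.finrank ℝ E : ℝ) - 1) ≠ 0 := by positivity
  field_simp
  field_simp at hD
  linarith [hD]

/-- **`ċ₁ = (2κ²/d²)·Σ_{k,m} ‖U_{km}‖²_HS`**: Lüscher's order-one constant — the variance of the
action (`luscher_constant_one_eq`) — in closed form, for every `C²` Lüscher series of `S`. -/
theorem luscher_constant_one_eq_sum (h2 : 2 ≤ Module.finrank ℝ E) (hU0 : ∀ n, U n n = 0)
    (hUadj : ∀ m n (v w : E), ⟪U m n v, w⟫ = ⟪v, U n m w⟫) (κ S₀ : ℝ)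
    {St : ℕ → (Λ → E) → ℝ} {c : ℕ → ℝ} (hSt : ∀ k, ContDiff ℝ 2 (St k))
    (h0 : ∀ ξ : Λ → sphere (0 : E) 1,
      -∑ n, siteLaplacian n (St 0) (fun m => (ξ m : E)) =
        esAction κ S₀ U (fun m => (ξ m : E)) + c 0)
    (hs : ∀ k, ∀ ξ : Λ → sphere (0 : E) 1,
      -∑ n, siteLaplacian n (St (k + 1)) (fun m => (ξ m : E)) =
        -(∑ n, ⟪siteGrad n (esAction κ S₀ U) (fun m => (ξ m : E)),
            siteGrad n (St k) (fun m => (ξ m : E))⟫) + c (k + 1)) :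
    c 1 = 2 * κ ^ 2 / (Module.finrank ℝ E : ℝ) ^ 2 *
      ∑ k, ∑ m, ∑ i, ‖U k m (stdOrthonormalBasis ℝ E i)‖ ^ 2 := by
  rw [luscher_constant_one_eq h2 hU0 hUadj κ S₀ hSt h0 hs, variance_esAction_eq h2 hU0 hUadj κ S₀]

omit [MeasurableSpace E] [BorelSpace E] [Fintype Λ] [DecidableEq Λ] [Nontrivial E] in
/-- An isometric transporter has `‖U‖²_HS = d`. -/
theorem sum_norm_sq_apply_of_isometric {V : E →L[ℝ] E} (hV : ∀ v, ‖V v‖ = ‖v‖) :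
    ∑ i, ‖V (stdOrthonormalBasis ℝ E i)‖ ^ 2 = (Module.finrank ℝ E : ℝ) := by
  simp_rw [hV, (stdOrthonormalBasis ℝ E).orthonormal.1, one_pow]
  simp

/-- **Isometric (or absent) transporters** — the CP(N−1) case of U(1) phases on the links of a
graph: `∫(S − S₀)² dπ̄ = (2κ²/d) · #{(k,m) : U_{km} ≠ 0}` (twice the number of links for a symmetric
coupling graph) — the variance of the action is linear in the number of links. -/
theorem variance_esAction_eq_of_isometric (h2 : 2 ≤ Module.finrank ℝ E) (hU0 : ∀ n, U n n = 0)
    (hUadj : ∀ m n (v w : E), ⟪U m n v, w⟫ = ⟪v, U n m w⟫)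
    (hiso : ∀ k m, U k m = 0 ∨ ∀ v, ‖U k m v‖ = ‖v‖) (κ S₀ : ℝ) :
    ∫ ω, (esAction κ S₀ U (fun n => ((ω : Λ → sphere (0 : E) 1) n : E)) - S₀) ^ 2
        ∂Measure.pi (fun _ : Λ => uniformSphere (volume : Measure E)) =
      2 * κ ^ 2 / (Module.finrank ℝ E : ℝ) * ({p : Λ × Λ | U p.1 p.2 ≠ 0}.ncard : ℝ) := by
  classical
  have hd : (Module.finrank ℝ E : ℝ) ≠ 0 := by
    have : (2 : ℝ) ≤ Module.finrank ℝ E := by exact_mod_cast h2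
    positivity
  rw [variance_esAction_eq h2 hU0 hUadj κ S₀]
  have hterm : ∀ k m, ∑ i, ‖U k m (stdOrthonormalBasis ℝ E i)‖ ^ 2 =
      if U k m = 0 then 0 else (Module.finrank ℝ E : ℝ) := fun k m => by
    rcases hiso k m with h | h
    · simp [h]
    · by_cases h0 : U k m = 0
      · simp [h0]
      · rw [if_neg h0, sum_norm_sq_apply_of_isometric h]
  simp_rw [hterm]
  have hcount : ∑ k, ∑ m, (if U k m = 0 then (0 : ℝ) else (Module.finrank ℝ E : ℝ)) =
      (Module.finrank ℝ E : ℝ) * ({p : Λ × Λ | U p.1 p.2 ≠ 0}.ncard : ℝ) := by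
    have e : ({p : Λ × Λ | U p.1 p.2 ≠ 0}.ncard : ℝ) =
        ((Finset.univ.filter fun p : Λ × Λ => U p.1 p.2 ≠ 0).card : ℝ) := by
      rw [← ncard_coe_finset]
      congr 2
      ext p
      simp
    rw [e, ← Finset.sum_product', Finset.univ_product_univ, Finset.card_eq_sum_ones, Nat.cast_sum,
      Finset.mul_sum, Finset.sum_filter]
    refine Finset.sum_congr rfl fun p _ => ?_
    by_cases h : U p.1 p.2 = 0 <;> simp [h]
  rw [hcount, div_mul_eq_mul_div, div_mul_eq_mul_div, div_eq_div_iff (pow_ne_zero 2 hd) hd]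
  ring

end Variance

end Summit.Ventures.LatticeQCDFlow.Exactness

end
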